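import Summits.CriticalPhenomena.PercolationContinuityZ3.Theorems.PercNearOneGluingNoHeavyLowerTailSunflowerCappedPendant
import HarnessLib

/-!
# `NoHeavyLowerTail` (crux stmt-CriticalPhenomena-4575), abstract sunflower cubic: the capped pendant lemma ON THE TWO
# DIAGONAL CLASSES — (RES0′) for all `n` for every family whose petals all lie on one side of the diagonal `a₀·A = A₀·g`

Support file (seat `prim-ineq-prove-1` gen 62; `--supports stmt-CriticalPhenomena-4575`).  No `sorry`, no named facts.
Memo: run/shared/lean/prim/prim-ineq-prove-1/FINDING-TBERN-prove1-g62.md §2.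

THE CHANGE OF COORDINATES.  In the capped pendant lemma (`CappedPendant s t b β V`, `…SunflowerCappedPendant`) the petal factor
is `st + s(1−t)vv + (1−s)t·u + (1−s)(1−t)m = t·A + (1−t)·g` with the ONE-COIN AVERAGES `A := s + (1−s)u` (the `T = 1` row) and
`g := (1−s)m + s·vv` (the `T = 0` row); the target base is `c = t·A₀ + (1−t)·a₀` (`A₀ = s + (1−s)b`, `a₀ = (1−s)b + sβ`) and the
target top factor is `t·1 + (1−t)·V`.  In the normalised coordinates `α = A/A₀ ≥ 1`, `γ = g/a₀ ≥ 1` the factor is the LINEAR form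
`pfun 0 (tA₀) ((1−t)a₀) α γ` of `…SunflowerPendantAnalytic` with NO constant term, so the two-petal merging identity
`ψ(1,1)ψ(α₁α₂,γ₁γ₂) − ψ(α₁,γ₁)ψ(α₂,γ₂) = t(1−t)A₀a₀(α₁−γ₁)(α₂−γ₂)` has no defect terms: petals on the same side of the diagonal
`α = γ` (i.e. `a₀A = A₀g`) merge for free, and the merged `A`-product obeys the one-coin budget `∏ A_j ≤ A₀^(n−1)` (`prod_wavg_le`),
the merged `g`-product the budget `∏ g_j ≤ a₀^(n−1)V`.  Hence:
* `cpl_of_gammaHeavy`: if EVERY petal is `γ`-heavy, `a₀(s + (1−s)u_j) ≤ A₀((1−s)m_j + s·vv_j)`, the conclusion of the capped pendant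
  lemma holds — from the `u`-budget and the `g`-budget ALONE (no `vv`-budget, no links `m ≤ u`, `m ≤ vv`, no caps).  In the
  `(x, y) = (u/b, g/a₀)` coordinates of the pendant proof the dwarf `(β,β,β)`, every sub-dwarf, every `h`-petal `(b, vv, b)` and every
  `L1`-tight petal with `u ≤ vv` is `γ`-heavy (the dwarf is `u`-heavy in `(x,y)` but `γ`-heavy in `(α,γ)`), so the dwarf-pack + `h`-petal
  families of the gen-61 census are covered;
* `cpl_of_uHeavy`: the mirror statement when every petal is `u`-heavy, `A₀((1−s)m_j + s vv_j) ≤ a₀(s + (1−s)u_j)`;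
* `res0_of_gammaHeavy`: the model corollary through the dictionary of `res0_of_cappedPendant` — the sharp (RES0′)
  `∏ G_j ≤ (g*)^(|S|−1)·a` for every `n` and every family whose petals all satisfy
  `b_H̃·(σ + (1−σ)Ȳ_j) ≤ (σ + (1−σ)b_Ȳ)·H̃_j` (`Ȳ = (1−s)y + sk`, `H̃ = sH + (1−s)α₀₀`, `b_H̃ = s b_H + (1−s)α₀₀`), from `(BȲ)` and `(BH)`.
The mixed case (petals on both sides) is the open part; the memo records the coefficientwise (in `t`) strengthening that survives
all numerical attacks and the two-class merged endgame that does not.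
-/

noncomputable section

namespace Summit.CriticalPhenomena.PercolationContinuityZ3.Theorems.SunflowerPartition

namespace SafeCalc

namespace LinkedCurrency

open Finset Pendant

variable {κ : Type*}

/-- The `A`-budget: `∏ (s + (1−s)u_j) ≤ (s + (1−s)b)^(n−1)` from `∏ u_j ≤ b^(n−1)`, `b ≤ u_j` (one coin, `prod_wavg_le`).
[this work] -/
theorem prod_A_le {n : ℕ} {s b : ℝ} (hb : 0 < b) (hs : 0 ≤ s) (hs1 : s ≤ 1) (hn : 0 < n) (u : Fin n → ℝ)
    (hub : ∀ j, b ≤ u j) (hpu : ∏ j, u j ≤ b ^ (n - 1)) :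
    ∏ j, (s + (1 - s) * u j) ≤ (s + (1 - s) * b) ^ (n - 1) := by
  classical
  have hs' : 0 ≤ 1 - s := sub_nonneg.2 hs1
  have hs'1 : 1 - s ≤ 1 := by linarith
  have hne : (univ : Finset (Fin n)).Nonempty := univ_nonempty_iff.2 ⟨⟨0, hn⟩⟩
  have h1 := prod_wavg_le (s := 1 - s) (e := 1) (f := b) hs' hs'1 zero_le_one hb univ hne u (fun j _ => hub j)
    (by rw [card_univ, Fintype.card_fin]; exact hpu)
  rw [card_univ, Fintype.card_fin] at h1
  have h2 : ∀ j, s + (1 - s) * u j = (1 - s) * u j + (1 - (1 - s)) * 1 := fun j => by ring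
  have h3 : ((1 - s) * b + (1 - (1 - s)) * 1) ^ (n - 1) * ((1 - s) + (1 - (1 - s)) * 1) = (s + (1 - s) * b) ^ (n - 1) := by
    have : (1 - s) * b + (1 - (1 - s)) * 1 = s + (1 - s) * b := by ring
    rw [this]; ring
  calc ∏ j, (s + (1 - s) * u j) = ∏ j, ((1 - s) * u j + (1 - (1 - s)) * 1) := prod_congr rfl (fun j _ => h2 j)
    _ ≤ ((1 - s) * b + (1 - (1 - s)) * 1) ^ (n - 1) * ((1 - s) + (1 - (1 - s)) * 1) := h1
    _ = (s + (1 - s) * b) ^ (n - 1) := h3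

/-- **The capped pendant lemma for `γ`-HEAVY families.**  Coins `s, t ∈ [0,1]`, floors `0 < b ≤ β`, cap `V`; petals
`(u_j, vv_j, m_j)` with `b ≤ u_j`, `β ≤ vv_j`, `b ≤ m_j` and EVERY petal `γ`-heavy:
`((1−s)b + sβ)·(s + (1−s)u_j) ≤ (s + (1−s)b)·((1−s)m_j + s vv_j)`; budgets `∏ u_j ≤ b^(n−1)` and
`∏ ((1−s)m_j + s vv_j) ≤ ((1−s)b + sβ)^(n−1)·V`.  Then
`∏ (st + s(1−t)vv_j + (1−s)t u_j + (1−s)(1−t)m_j) ≤ (st + s(1−t)β + (1−s)b)^(n−1)·(t + (1−t)V)`.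
No `vv`-budget, no links and no caps are needed. [this work] -/
theorem cpl_of_gammaHeavy {n : ℕ} {s t b β V : ℝ} (hb : 0 < b) (hbβ : b ≤ β) (hs : 0 ≤ s) (hs1 : s ≤ 1) (ht : 0 ≤ t)
    (ht1 : t ≤ 1) (u vv m : Fin n → ℝ) (hub : ∀ j, b ≤ u j) (hvβ : ∀ j, β ≤ vv j) (hmb : ∀ j, b ≤ m j)
    (hheavy : ∀ j, ((1 - s) * b + s * β) * (s + (1 - s) * u j) ≤ (s + (1 - s) * b) * ((1 - s) * m j + s * vv j))
    (hpu : ∏ j, u j ≤ b ^ (n - 1))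
    (hpg : ∏ j, ((1 - s) * m j + s * vv j) ≤ ((1 - s) * b + s * β) ^ (n - 1) * V) :
    ∏ j, (s * t + s * (1 - t) * vv j + (1 - s) * t * u j + (1 - s) * (1 - t) * m j) ≤
      (s * t + s * (1 - t) * β + (1 - s) * b) ^ (n - 1) * (t + (1 - t) * V) := by
  classical
  have hs' : 0 ≤ 1 - s := sub_nonneg.2 hs1
  have ht' : 0 ≤ 1 - t := sub_nonneg.2 ht1
  set a₀ : ℝ := (1 - s) * b + s * β with ha₀
  set A₀ : ℝ := s + (1 - s) * b with hA₀
  have ha₀pos : 0 < a₀ := by rw [ha₀]; nlinarith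
  have hA₀pos : 0 < A₀ := by
    rw [hA₀]
    rcases eq_or_lt_of_le hs1 with h | h
    · rw [h]; norm_num
    · nlinarith [mul_pos (sub_pos.2 h) hb]
  rcases Nat.eq_zero_or_pos n with hn | hn
  · -- `n = 0`: the `g`-budget forces `1 ≤ V`
    subst hn
    simp only [univ_eq_empty, prod_empty, Nat.zero_sub, pow_zero, one_mul] at hpg ⊢
    nlinarith
  -- normalised coordinates
  set x : Fin n → ℝ := fun j => (s + (1 - s) * u j) / A₀ with hx
  set y : Fin n → ℝ := fun j => ((1 - s) * m j + s * vv j) / a₀ with hy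
  have hx1 : ∀ j, 1 ≤ x j := fun j => by
    simp only [hx]; rw [le_div_iff₀ hA₀pos, one_mul, hA₀]; nlinarith [hub j]
  have hxy : ∀ j, x j ≤ y j := fun j => by
    simp only [hx, hy]; rw [div_le_div_iff₀ hA₀pos ha₀pos]
    have := hheavy j; linarith
  have hne : (univ : Finset (Fin n)).Nonempty := univ_nonempty_iff.2 ⟨⟨0, hn⟩⟩
  have hτ0 : 0 ≤ t * A₀ := mul_nonneg ht hA₀pos.le
  have hρ0 : 0 ≤ (1 - t) * a₀ := mul_nonneg ht' ha₀pos.le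
  have key := prod_pfun_le_merged' (σ := 0) le_rfl hτ0 hρ0 x y univ hne (fun j _ => hx1 j) (fun j _ => hxy j)
  rw [card_univ, Fintype.card_fin] at key
  -- the factors and the base in terms of `pfun`
  have hfac : ∀ j, s * t + s * (1 - t) * vv j + (1 - s) * t * u j + (1 - s) * (1 - t) * m j =
      pfun 0 (t * A₀) ((1 - t) * a₀) (x j) (y j) := by
    intro j; simp only [pfun, hx, hy]; field_simp; ring
  have hc : pfun 0 (t * A₀) ((1 - t) * a₀) 1 1 = s * t + s * (1 - t) * β + (1 - s) * b := by
    simp only [pfun, ha₀, hA₀]; ring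
  -- the two budgets
  have hA : A₀ * ∏ j, x j ≤ 1 := by
    have h1 := prod_A_le hb hs hs1 hn u hub hpu
    have hpow : A₀ ^ n = A₀ * A₀ ^ (n - 1) := by
      conv_lhs => rw [show n = (n - 1) + 1 by omega, pow_succ]
      ring
    simp only [hx]
    rw [prod_div_distrib, prod_const, card_univ, Fintype.card_fin, hpow, mul_div_assoc', div_le_one (by positivity)]
    rw [← hA₀] at h1
    exact mul_le_mul_of_nonneg_left h1 hA₀pos.le
  have hG : a₀ * ∏ j, y j ≤ V := by
    have hpow : a₀ ^ n = a₀ * a₀ ^ (n - 1) := by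
      conv_lhs => rw [show n = (n - 1) + 1 by omega, pow_succ]
      ring
    simp only [hy]
    rw [prod_div_distrib, prod_const, card_univ, Fintype.card_fin, hpow, mul_div_assoc',
      div_le_iff₀ (by positivity)]
    calc a₀ * ∏ j, ((1 - s) * m j + s * vv j) ≤ a₀ * (a₀ ^ (n - 1) * V) := mul_le_mul_of_nonneg_left hpg ha₀pos.le
      _ = V * (a₀ * a₀ ^ (n - 1)) := by ring
  have htop : pfun 0 (t * A₀) ((1 - t) * a₀) (∏ j, x j) (∏ j, y j) ≤ t + (1 - t) * V := by
    simp only [pfun]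
    have e1 := mul_le_mul_of_nonneg_left hA ht
    have e2 := mul_le_mul_of_nonneg_left hG ht'
    nlinarith
  have hcnn : 0 ≤ s * t + s * (1 - t) * β + (1 - s) * b := by
    have := hb.le.trans hbβ; positivity
  rw [prod_congr rfl fun j _ => hfac j]
  rw [hc] at key
  exact key.trans (mul_le_mul_of_nonneg_left htop (pow_nonneg hcnn _))

/-- **The capped pendant lemma for `u`-HEAVY families** (mirror of `cpl_of_gammaHeavy`): every petal satisfies
`(s + (1−s)b)·((1−s)m_j + s vv_j) ≤ ((1−s)b + sβ)·(s + (1−s)u_j)`. [this work] -/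
theorem cpl_of_uHeavy {n : ℕ} {s t b β V : ℝ} (hb : 0 < b) (hbβ : b ≤ β) (hs : 0 ≤ s) (hs1 : s ≤ 1) (ht : 0 ≤ t)
    (ht1 : t ≤ 1) (u vv m : Fin n → ℝ) (hub : ∀ j, b ≤ u j) (hvβ : ∀ j, β ≤ vv j) (hmb : ∀ j, b ≤ m j)
    (hheavy : ∀ j, (s + (1 - s) * b) * ((1 - s) * m j + s * vv j) ≤ ((1 - s) * b + s * β) * (s + (1 - s) * u j))
    (hpu : ∏ j, u j ≤ b ^ (n - 1))
    (hpg : ∏ j, ((1 - s) * m j + s * vv j) ≤ ((1 - s) * b + s * β) ^ (n - 1) * V) :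
    ∏ j, (s * t + s * (1 - t) * vv j + (1 - s) * t * u j + (1 - s) * (1 - t) * m j) ≤
      (s * t + s * (1 - t) * β + (1 - s) * b) ^ (n - 1) * (t + (1 - t) * V) := by
  classical
  have hs' : 0 ≤ 1 - s := sub_nonneg.2 hs1
  have ht' : 0 ≤ 1 - t := sub_nonneg.2 ht1
  set a₀ : ℝ := (1 - s) * b + s * β with ha₀
  set A₀ : ℝ := s + (1 - s) * b with hA₀
  have ha₀pos : 0 < a₀ := by rw [ha₀]; nlinarith
  have hA₀pos : 0 < A₀ := by
    rw [hA₀]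
    rcases eq_or_lt_of_le hs1 with h | h
    · rw [h]; norm_num
    · nlinarith [mul_pos (sub_pos.2 h) hb]
  rcases Nat.eq_zero_or_pos n with hn | hn
  · subst hn
    simp only [univ_eq_empty, prod_empty, Nat.zero_sub, pow_zero, one_mul] at hpg ⊢
    nlinarith
  set x : Fin n → ℝ := fun j => (s + (1 - s) * u j) / A₀ with hx
  set y : Fin n → ℝ := fun j => ((1 - s) * m j + s * vv j) / a₀ with hy
  have hy1 : ∀ j, 1 ≤ y j := fun j => by
    simp only [hy]; rw [le_div_iff₀ ha₀pos, one_mul, ha₀]; nlinarith [hmb j, hvβ j]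
  have hyx : ∀ j, y j ≤ x j := fun j => by
    simp only [hx, hy]; rw [div_le_div_iff₀ ha₀pos hA₀pos]
    have := hheavy j; linarith
  have hne : (univ : Finset (Fin n)).Nonempty := univ_nonempty_iff.2 ⟨⟨0, hn⟩⟩
  have hτ0 : 0 ≤ t * A₀ := mul_nonneg ht hA₀pos.le
  have hρ0 : 0 ≤ (1 - t) * a₀ := mul_nonneg ht' ha₀pos.le
  have key := prod_pfun_le_merged (σ := 0) le_rfl hτ0 hρ0 x y univ hne (fun j _ => hy1 j) (fun j _ => hyx j)
  rw [card_univ, Fintype.card_fin] at key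
  have hfac : ∀ j, s * t + s * (1 - t) * vv j + (1 - s) * t * u j + (1 - s) * (1 - t) * m j =
      pfun 0 (t * A₀) ((1 - t) * a₀) (x j) (y j) := by
    intro j; simp only [pfun, hx, hy]; field_simp; ring
  have hc : pfun 0 (t * A₀) ((1 - t) * a₀) 1 1 = s * t + s * (1 - t) * β + (1 - s) * b := by
    simp only [pfun, ha₀, hA₀]; ring
  have hA : A₀ * ∏ j, x j ≤ 1 := by
    have h1 := prod_A_le hb hs hs1 hn u hub hpu
    have hpow : A₀ ^ n = A₀ * A₀ ^ (n - 1) := by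
      conv_lhs => rw [show n = (n - 1) + 1 by omega, pow_succ]
      ring
    simp only [hx]
    rw [prod_div_distrib, prod_const, card_univ, Fintype.card_fin, hpow, mul_div_assoc', div_le_one (by positivity)]
    rw [← hA₀] at h1
    exact mul_le_mul_of_nonneg_left h1 hA₀pos.le
  have hG : a₀ * ∏ j, y j ≤ V := by
    have hpow : a₀ ^ n = a₀ * a₀ ^ (n - 1) := by
      conv_lhs => rw [show n = (n - 1) + 1 by omega, pow_succ]
      ring
    simp only [hy]
    rw [prod_div_distrib, prod_const, card_univ, Fintype.card_fin, hpow, mul_div_assoc',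
      div_le_iff₀ (by positivity)]
    calc a₀ * ∏ j, ((1 - s) * m j + s * vv j) ≤ a₀ * (a₀ ^ (n - 1) * V) := mul_le_mul_of_nonneg_left hpg ha₀pos.le
      _ = V * (a₀ * a₀ ^ (n - 1)) := by ring
  have htop : pfun 0 (t * A₀) ((1 - t) * a₀) (∏ j, x j) (∏ j, y j) ≤ t + (1 - t) * V := by
    simp only [pfun]
    have e1 := mul_le_mul_of_nonneg_left hA ht
    have e2 := mul_le_mul_of_nonneg_left hG ht'
    nlinarith
  have hcnn : 0 ≤ s * t + s * (1 - t) * β + (1 - s) * b := by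
    have := hb.le.trans hbβ; positivity
  rw [prod_congr rfl fun j _ => hfac j]
  rw [hc] at key
  exact key.trans (mul_le_mul_of_nonneg_left htop (pow_nonneg hcnn _))

/-- **(RES0′) FOR ALL `n` ON THE `γ`-HEAVY CLASS** (model form; dictionary of `res0_of_cappedPendant`).  Coins
`τ, σ, s ∈ [0,1]`, floors `0 < α₀₀ ≤ α₀₁ ≤ α₁₁`; petals `j ∈ S` (nonempty) with `α₀₀ ≤ y_j`, `α₀₁ ≤ k_j`, `α₀₁ ≤ g_j`, `α₁₁ ≤ h_j`
(no caps, no links); budgets `(BȲ)` and `(BH)` only; and every petal `γ`-heavy in the `w`-averaged square: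
`b_H̃·(σ + (1−σ)Ȳ_j) ≤ (σ + (1−σ)b_Ȳ)·H̃_j`, where `Ȳ_j = (1−s)y_j + sk_j`, `b_Ȳ = (1−s)α₀₀ + sα₀₁`, `H̃_j = s((1−σ)g_j + σh_j) + (1−s)α₀₀`,
`b_H̃ = s((1−σ)α₀₁ + σα₁₁) + (1−s)α₀₀`.  Then `∏_S G_j ≤ (g*)^(|S|−1)·a`, `a = G(full)`. [this work] -/
theorem res0_of_gammaHeavy [DecidableEq κ] {τ σ s α00 α01 α11 : ℝ} (hτ0 : 0 ≤ τ) (hτ1 : τ ≤ 1) (hσ0 : 0 ≤ σ)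
    (hσ1 : σ ≤ 1) (hs0 : 0 ≤ s) (hs1 : s ≤ 1) (hα0 : 0 < α00) (h01 : α00 ≤ α01) (h11 : α01 ≤ α11)
    (S : Finset κ) (hS : S.Nonempty) (y k gc h : κ → ℝ)
    (hy : ∀ j ∈ S, α00 ≤ y j) (hk : ∀ j ∈ S, α01 ≤ k j) (hg : ∀ j ∈ S, α01 ≤ gc j) (hh : ∀ j ∈ S, α11 ≤ h j)
    (hheavy : ∀ j ∈ S, (s * ((1 - σ) * α01 + σ * α11) + (1 - s) * α00) * (σ + (1 - σ) * ((1 - s) * y j + s * k j)) ≤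
      (σ + (1 - σ) * ((1 - s) * α00 + s * α01)) * (s * ((1 - σ) * gc j + σ * h j) + (1 - s) * α00))
    (hBY : ∏ j ∈ S, ((1 - s) * y j + s * k j) ≤ ((1 - s) * α00 + s * α01) ^ (S.card - 1))
    (hBH : ∏ j ∈ S, ((1 - σ) * gc j + σ * h j) ≤ ((1 - σ) * α01 + σ * α11) ^ (S.card - 1)) :
    ∏ j ∈ S, (τ * σ + (1 - τ) * (1 - s) * α00 + τ * (1 - σ) * ((1 - s) * y j + s * k j) +
        s * (1 - τ) * ((1 - σ) * gc j + σ * h j)) ≤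
      (τ * σ + (1 - τ) * (1 - s) * α00 + τ * (1 - σ) * ((1 - s) * α00 + s * α01) +
        s * (1 - τ) * ((1 - σ) * α01 + σ * α11)) ^ (S.card - 1) *
        (τ * σ + (1 - τ) * (1 - s) * α00 + τ * (1 - σ) + s * (1 - τ)) := by
  classical
  have hs' : 0 ≤ 1 - s := sub_nonneg.2 hs1
  have hσ' : 0 ≤ 1 - σ := sub_nonneg.2 hσ1
  have hα01 : 0 < α01 := hα0.trans_le h01
  have hα11 : 0 < α11 := hα01.trans_le h11
  set e := S.equivFin with he
  have mem : ∀ i : Fin S.card, ((e.symm i : S) : κ) ∈ S := fun i => (e.symm i).2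
  set u : Fin S.card → ℝ := fun i => (1 - s) * y ((e.symm i : S) : κ) + s * k ((e.symm i : S) : κ) with hu
  set vv : Fin S.card → ℝ := fun i => s * h ((e.symm i : S) : κ) + (1 - s) * α00 with hvv
  set m : Fin S.card → ℝ := fun i => s * gc ((e.symm i : S) : κ) + (1 - s) * α00 with hm
  set b : ℝ := (1 - s) * α00 + s * α01 with hb
  set β : ℝ := s * α11 + (1 - s) * α00 with hβ
  set V : ℝ := s + (1 - s) * α00 with hV
  have hbpos : 0 < b := by rw [hb]; nlinarith
  have hbβ : b ≤ β := by rw [hb, hβ]; nlinarith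
  have hbH : 0 < (1 - σ) * α01 + σ * α11 := by nlinarith
  have hBg : ∏ i, ((1 - σ) * m i + σ * vv i) ≤ ((1 - σ) * b + σ * β) ^ (S.card - 1) * V := by
    have h1 := prod_wavg_le hs0 hs1 hα0.le hbH S hS (fun j => (1 - σ) * gc j + σ * h j)
      (fun j hj => by nlinarith [hg j hj, hh j hj]) hBH
    have h2 : ∏ i, ((1 - σ) * m i + σ * vv i) = ∏ j ∈ S, (s * ((1 - σ) * gc j + σ * h j) + (1 - s) * α00) := by
      rw [hm, hvv, prod_eq_prod_fin_equiv S (fun j => s * ((1 - σ) * gc j + σ * h j) + (1 - s) * α00)]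
      exact Fintype.prod_congr _ _ (fun i => by ring)
    have h3 : s * ((1 - σ) * α01 + σ * α11) + (1 - s) * α00 = (1 - σ) * b + σ * β := by rw [hb, hβ]; ring
    rw [h2, ← h3, hV]; exact h1
  have hBu : ∏ i, u i ≤ b ^ (S.card - 1) := by
    rw [hu, hb, ← prod_eq_prod_fin_equiv S (fun j => (1 - s) * y j + s * k j)]; exact hBY
  have key := cpl_of_gammaHeavy (n := S.card) (s := σ) (t := τ) hbpos hbβ hσ0 hσ1 hτ0 hτ1 u vv m
    (fun i => by show b ≤ u i; rw [hb, hu]; nlinarith [hy _ (mem i), hk _ (mem i)])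
    (fun i => by show β ≤ vv i; rw [hβ, hvv]; nlinarith [hh _ (mem i)])
    (fun i => by show b ≤ m i; rw [hb, hm]; nlinarith [hg _ (mem i)])
    (fun i => by
      show ((1 - σ) * b + σ * β) * (σ + (1 - σ) * u i) ≤ (σ + (1 - σ) * b) * ((1 - σ) * m i + σ * vv i)
      have h1 := hheavy _ (mem i)
      have e1 : (1 - σ) * b + σ * β = s * ((1 - σ) * α01 + σ * α11) + (1 - s) * α00 := by rw [hb, hβ]; ring
      have e2 : (1 - σ) * m i + σ * vv i =
          s * ((1 - σ) * gc ((e.symm i : S) : κ) + σ * h ((e.symm i : S) : κ)) + (1 - s) * α00 := by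
        rw [hm, hvv]; ring
      rw [e1, e2, hu, hb]; exact h1)
    hBu hBg
  have e1 : ∏ j ∈ S, (τ * σ + (1 - τ) * (1 - s) * α00 + τ * (1 - σ) * ((1 - s) * y j + s * k j) +
        s * (1 - τ) * ((1 - σ) * gc j + σ * h j)) =
      ∏ i : Fin S.card, (σ * τ + σ * (1 - τ) * vv i + (1 - σ) * τ * u i + (1 - σ) * (1 - τ) * m i) := by
    rw [prod_eq_prod_fin_equiv S]
    refine Fintype.prod_congr _ _ (fun i => ?_)
    rw [hu, hvv, hm]; ring
  rw [e1]
  refine key.trans (le_of_eq ?_)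
  rw [hb, hβ, hV]; ring

end LinkedCurrency

end SafeCalc

end Summit.CriticalPhenomena.PercolationContinuityZ3.Theorems.SunflowerPartition
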